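import Mathlib.Analysis.Normed.Group.Tannery
import Mathlib.Analysis.Complex.Exponential
import Literature.Analysis.FunctionSpaces.TorusFourierSynthesis
import Literature.Analysis.FunctionSpaces.LatticeSobolevRellich
import Literature.Analysis.FunctionSpaces.TorusHNegOnePairing
import Literature.Analysis.FunctionSpaces.TorusWeightedGalerkinCoefficients
import HarnessLib

/-!
# Compactness of Gevrey balls of smooth divergence-free fields on the flat torus `T^d`

Analysis/FunctionSpaces support file (everything proved; no definitions, no named facts). A sequence
`vₙ : T^d → ℝ^d` of smooth, divergence-free, mean-zero vector fields whose Fourier coefficients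
`v̂ₙ(k) = 𝓕(complexify ∘ vₙ)(k)` obey a **uniform Gevrey bound**
`∑_{k ∈ S} e^{2σ|k|} ‖v̂ₙ(k)‖² ≤ C` for all finite `S ⊆ ℤ^d` (`σ > 0`, `|k| = (freqNormSq k)^{1/2}`) has
a subsequence converging **in `H¹`** (`∫ ‖v_{ψ n} - w‖² → 0` and `‖∇(v_{ψ n} - w)‖₂² → 0`) to a smooth,
divergence-free, mean-zero field `w` obeying the same Gevrey bound: the Gevrey balls of Foias–Temam
(1989) are compact in every Sobolev topology. This is the compactness step that turns uniform Gevrey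
(analyticity-radius) bounds on bounded-enstrophy Navier–Stokes trajectories into smooth `H¹`-limits.

## The proof

1. *Modewise bounds and diagonal extraction* (`Torus.exists_strictMono_tendsto_of_gevrey_bound`): with
   `S = {k}`, `‖v̂ₙ(k)‖² ≤ C e^{-2σ|k|}`, so every coordinate sequence is bounded in the proper space
   `ℂ^d` and the lattice diagonal procedure `Lattice.exists_strictMono_forall_tendsto_apply`
   (Warner 1983, Lemma 6.23) gives `ψ` and limits `b(k)`; finite sums pass to the limit, so `b` obeys
   the Gevrey bound.
2. *Gevrey decay is rapid decay* (`Torus.summable_one_add_freqNormSq_pow_mul_exp_neg`,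
   `Torus.rapidDecay_of_norm_sq_le_mul_exp_neg`): `(1 + t²)^m e^{-at} ≤ (2m)! a^{-2m} e^{a}` for `t ≥ 0`
   (`Real.pow_div_factorial_le_exp`) and `∑ₖ (1 + |k|²)^{-#d} < ∞`.
3. *Real synthesis* (`Torus.RapidDecay.conjVec_fourierSynth_apply`, `…complexify_realPart_fourierSynth`,
   `…mFourierCoeff_realPart_fourierSynth`): the coefficients of real fields are conjugate symmetric
   (`Torus.isConjSymm_mFourierCoeff`), this passes to the limit `b`, so `w := Re ∘ fourierSynth b` is a
   smooth real field with `𝓕(complexify ∘ w) = b` (Grafakos 2014, Prop. 3.2.5, §3.3.3).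
4. *Constraints pass to the limit modewise*: `∑ⱼ kⱼ v̂ₙ(k)ⱼ = 0` and `v̂ₙ(0) = 0`
   (`Torus.IsDivFree.sum_mul_mFourierCoeff_eq_zero`, `Torus.mFourierCoeff_complexify_zero_of_hasZeroMean`)
   give the same for `b`, whence `div w = 0` and `∫ w = 0`
   (`Torus.isDivFree_of_sum_mul_mFourierCoeff_eq_zero`, `Torus.hasZeroMean_of_mFourierCoeff_zero`).
5. *`H¹` convergence* (`Torus.exists_smooth_limit_of_gevrey_bound`): by Parseval
   (`Torus.hasSum_sq_norm_mFourierCoeff_complexify`,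
   `Torus.tsum_freqNormSq_mul_enorm_sq_mFourierCoeff_complexify`) both `∫ ‖v_{ψ n} - w‖²` and
   `(4π²)⁻¹‖∇(v_{ψ n} - w)‖₂²` are at most `∑ₖ (1 + |k|²) ‖v̂_{ψ n}(k) - b(k)‖²`, which tends to `0` by
   Tannery's theorem (dominated convergence over `ℤ^d`, majorant `4C (1 + |k|²) e^{-2σ|k|}`).

## Mathlib / tree search

Tree (reused): `Torus.RapidDecay`, `Torus.fourierSynth` and its smoothness/coefficients
(`TorusFourierSynthesis`), `Lattice.exists_strictMono_forall_tendsto_apply` (`LatticeSobolevRellich`),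
`EuclideanSpace.realPart`, `EuclideanSpace.conjVec(L)`, `Torus.IsConjSymm`, `Torus.isConjSymm_mFourierCoeff`,
`Torus.mFourierCoeff_sub`, `Torus.complexify_comp_sub` (`TorusTrigPoly`),
`Torus.isDivFree_of_sum_mul_mFourierCoeff_eq_zero` (`TorusLerayHelmholtzProofs`),
`Torus.summable_inv_one_add_freqNormSq_pow_card` (`TorusFourierSeries`), Mathlib
`tendsto_tsum_of_dominated_convergence` (Tannery), `Real.pow_div_factorial_le_exp`. The `Fin 3`,
FluidPDE-layer special cases `SteadyLattice.conjVec_fourierSynth` / `SteadyLattice.realSynth_spec`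
(`FluidPDE/SteadyNSLatticePersistence`) are subsumed by §3 here (general `d`, FunctionSpaces layer).
Searched `Gevrey`, `exp.*freqNormSq.*RapidDecay`, `compact.*Gevrey` in the tree: nothing on the torus side.

## References

* C. Foias, R. Temam, *Gevrey class regularity for the solutions of the Navier–Stokes equations*,
  J. Funct. Anal. 87 (1989), 359–369 (the Gevrey classes `D(e^{σA^{1/2}})`). [FoiasTemam1989]
* F. W. Warner, *Foundations of Differentiable Manifolds and Lie Groups*, GTM 94 (1983), Lemma 6.23
  (diagonal extraction / Rellich). [WarnerGTM94]
* L. Grafakos, *Classical Fourier Analysis*, 3rd ed., GTM 249 (2014), Prop. 3.2.5, Prop. 3.2.7 (3),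
  §3.3.3. [Grafakos2014]
-/

noncomputable section

open _root_.MeasureTheory Set Filter Function UnitAddTorus
open scoped Topology ENNReal BigOperators

namespace Literature.Analysis.FunctionSpaces

namespace Torus

variable {d : Type*} [Fintype d]

/-! ### Gevrey weights dominate polynomial weights -/

omit [Fintype d] in
/-- `(1 + t²)^m e^{-a t} ≤ (2m)! a^{-2m} e^{a}` for `t ≥ 0`, `a > 0` (from `xⁿ/n! ≤ eˣ` at
`x = a(1 + t)` and `1 + t² ≤ (1 + t)²`). [folklore] -/
theorem one_add_sq_pow_mul_exp_neg_le {a : ℝ} (ha : 0 < a) (m : ℕ) {t : ℝ} (ht : 0 ≤ t) :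
    (1 + t ^ 2) ^ m * Real.exp (-(a * t)) ≤ (2 * m).factorial / a ^ (2 * m) * Real.exp a := by
  have h0 : 1 + t ^ 2 ≤ (1 + t) ^ 2 := by nlinarith
  have h1 : (1 + t ^ 2) ^ m ≤ (1 + t) ^ (2 * m) := by
    rw [pow_mul]
    exact pow_le_pow_left₀ (by positivity) h0 m
  have h2 := Real.pow_div_factorial_le_exp (x := a * (1 + t)) (by positivity) (2 * m)
  have hfac : (0 : ℝ) < (2 * m).factorial := by exact_mod_cast Nat.factorial_pos _
  have hapow : 0 < a ^ (2 * m) := pow_pos ha _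
  rw [div_le_iff₀ hfac, mul_pow, mul_add, mul_one, Real.exp_add] at h2
  -- `h2 : a^(2m) (1+t)^(2m) ≤ e^a e^{at} (2m)!`
  have hexp : 0 < Real.exp (a * t) := Real.exp_pos _
  rw [Real.exp_neg, ← div_eq_mul_inv, div_le_iff₀ hexp]
  calc (1 + t ^ 2) ^ m ≤ (1 + t) ^ (2 * m) := h1
    _ = (a ^ (2 * m) * (1 + t) ^ (2 * m)) / a ^ (2 * m) := by field_simp
    _ ≤ (Real.exp a * Real.exp (a * t) * (2 * m).factorial) / a ^ (2 * m) :=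
        div_le_div_of_nonneg_right h2 hapow.le
    _ = (2 * m).factorial / a ^ (2 * m) * Real.exp a * Real.exp (a * t) := by ring

/-- **Gevrey weights beat polynomial weights on the lattice**:
`∑_{k ∈ ℤ^d} (1 + |k|²)^m e^{-a|k|} < ∞` for `a > 0` (comparison with `∑ₖ (1 + |k|²)^{-#d} < ∞`,
`Torus.summable_inv_one_add_freqNormSq_pow_card`). [folklore] -/
theorem summable_one_add_freqNormSq_pow_mul_exp_neg {a : ℝ} (ha : 0 < a) (m : ℕ) :
    Summable fun k : d → ℤ =>
      (1 + freqNormSq k) ^ m * Real.exp (-(a * Real.sqrt (freqNormSq k))) := by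
  set K : ℝ := (2 * (m + Fintype.card d)).factorial / a ^ (2 * (m + Fintype.card d)) * Real.exp a
    with hK
  refine Summable.of_nonneg_of_le
    (fun k => mul_nonneg (one_add_freqNormSq_pow_nonneg k m) (Real.exp_pos _).le) (fun k => ?_)
    (summable_inv_one_add_freqNormSq_pow_card.mul_left K)
  have h := one_add_sq_pow_mul_exp_neg_le ha (m + Fintype.card d) (Real.sqrt_nonneg (freqNormSq k))
  rw [Real.sq_sqrt (freqNormSq_nonneg k)] at h
  have hpos : 0 < (1 + freqNormSq k) ^ Fintype.card d :=
    pow_pos (zero_lt_one.trans_le (one_le_one_add_freqNormSq k)) _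
  rw [le_mul_inv_iff₀ hpos]
  calc (1 + freqNormSq k) ^ m * Real.exp (-(a * Real.sqrt (freqNormSq k))) *
        (1 + freqNormSq k) ^ Fintype.card d
      = (1 + freqNormSq k) ^ (m + Fintype.card d) * Real.exp (-(a * Real.sqrt (freqNormSq k))) := by
        rw [pow_add]; ring
    _ ≤ K := h

/-- **Gevrey decay is rapid decay**: if `‖c k‖² ≤ C e^{-2σ|k|}` for all `k` with `σ > 0`, then
`c` decays rapidly (`∑ₖ (1 + |k|²)^m ‖c k‖ < ∞` for every `m`). [folklore] -/
theorem rapidDecay_of_norm_sq_le_mul_exp_neg {V : Type*} [NormedAddCommGroup V] [NormedSpace ℂ V]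
    {σ C : ℝ} (hσ : 0 < σ) {c : (d → ℤ) → V}
    (h : ∀ k, ‖c k‖ ^ 2 ≤ C * Real.exp (-(2 * σ * Real.sqrt (freqNormSq k)))) : RapidDecay c := by
  intro m
  have hC : 0 ≤ C := by
    have h0 := (sq_nonneg _).trans (h 0)
    exact nonneg_of_mul_nonneg_left h0 (Real.exp_pos _)
  -- `‖c k‖ ≤ √C e^{-σ|k|}`
  have hle : ∀ k, ‖c k‖ ≤ Real.sqrt C * Real.exp (-(σ * Real.sqrt (freqNormSq k))) := by
    intro k
    have hsq : C * Real.exp (-(2 * σ * Real.sqrt (freqNormSq k))) =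
        (Real.sqrt C * Real.exp (-(σ * Real.sqrt (freqNormSq k)))) ^ 2 := by
      rw [mul_pow, Real.sq_sqrt hC, sq, ← Real.exp_add]
      ring_nf
    have h' := h k
    rw [hsq] at h'
    exact (pow_le_pow_iff_left₀ (norm_nonneg _) (by positivity) two_ne_zero).1 h'
  refine Summable.of_nonneg_of_le
    (fun k => mul_nonneg (one_add_freqNormSq_pow_nonneg k m) (norm_nonneg _)) (fun k => ?_)
    ((summable_one_add_freqNormSq_pow_mul_exp_neg hσ m).mul_left (Real.sqrt C))
  calc (1 + freqNormSq k) ^ m * ‖c k‖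
      ≤ (1 + freqNormSq k) ^ m * (Real.sqrt C * Real.exp (-(σ * Real.sqrt (freqNormSq k)))) :=
        mul_le_mul_of_nonneg_left (hle k) (one_add_freqNormSq_pow_nonneg k m)
    _ = Real.sqrt C * ((1 + freqNormSq k) ^ m * Real.exp (-(σ * Real.sqrt (freqNormSq k)))) := by
        ring

/-! ### Diagonal extraction under a uniform Gevrey bound -/

/-- **Coefficient families under a uniform Gevrey bound have coordinatewise convergent
subsequences, and the limit obeys the same bound.** For `aₙ : ℤ^d → V` (`V` proper, e.g. `ℂ^d`)
with `∑_{k∈S} e^{2σ|k|} ‖aₙ(k)‖² ≤ C` for all `n` and all finite `S`: some subsequence `a_{φ n}`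
converges in every coordinate to a family `b` with `∑_{k∈S} e^{2σ|k|} ‖b(k)‖² ≤ C` for all finite `S`
(Warner 1983, Lemma 6.23, the diagonal process; finite sums pass to the limit). [folklore] -/
theorem exists_strictMono_tendsto_of_gevrey_bound {V : Type*} [NormedAddCommGroup V] [ProperSpace V]
    {σ C : ℝ} (a : ℕ → (d → ℤ) → V)
    (ha : ∀ n, ∀ S : Finset (d → ℤ),
      ∑ k ∈ S, Real.exp (2 * σ * Real.sqrt (freqNormSq k)) * ‖a n k‖ ^ 2 ≤ C) :
    ∃ φ : ℕ → ℕ, StrictMono φ ∧ ∃ b : (d → ℤ) → V,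
      (∀ k, Tendsto (fun n => a (φ n) k) atTop (𝓝 (b k))) ∧
      ∀ S : Finset (d → ℤ),
        ∑ k ∈ S, Real.exp (2 * σ * Real.sqrt (freqNormSq k)) * ‖b k‖ ^ 2 ≤ C := by
  -- modewise bound `e^{2σ|k|} ‖aₙ k‖² ≤ C`
  have hmode : ∀ n k, Real.exp (2 * σ * Real.sqrt (freqNormSq k)) * ‖a n k‖ ^ 2 ≤ C :=
    fun n k => by simpa using ha n {k}
  have hC : 0 ≤ C := by simpa using ha 0 ∅
  have hbdd : ∀ k, ∃ r : ℝ, ∀ n, ‖a n k‖ ≤ r := by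
    intro k
    refine ⟨Real.sqrt (C / Real.exp (2 * σ * Real.sqrt (freqNormSq k))), fun n => ?_⟩
    refine (Real.le_sqrt (norm_nonneg _) (div_nonneg hC (Real.exp_pos _).le)).2 ?_
    rw [le_div_iff₀ (Real.exp_pos _), mul_comm]
    exact hmode n k
  obtain ⟨φ, hφ, hconv⟩ := Lattice.exists_strictMono_forall_tendsto_apply hbdd
  choose b hb using hconv
  refine ⟨φ, hφ, b, hb, fun S => ?_⟩
  have hlim : Tendsto
      (fun n => ∑ k ∈ S, Real.exp (2 * σ * Real.sqrt (freqNormSq k)) * ‖a (φ n) k‖ ^ 2) atTop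
      (𝓝 (∑ k ∈ S, Real.exp (2 * σ * Real.sqrt (freqNormSq k)) * ‖b k‖ ^ 2)) :=
    tendsto_finsetSum S fun k _ => (((hb k).norm).pow 2).const_mul _
  exact le_of_tendsto' hlim fun n => ha (φ n) S

/-! ### Real fields synthesised from conjugate-symmetric rapidly decaying families -/

/-- **The synthesis of a conjugate-symmetric family is real**: `conj (F_c x) = F_c x` for a rapidly
decaying `c : ℤ^d → ℂ^d` with `c(-k) = conj c(k)` (reindex `k ↦ -k` in the absolutely convergent
series; Grafakos 2014, Prop. 3.2.5). [folklore] -/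
theorem RapidDecay.conjVec_fourierSynth_apply {c : (d → ℤ) → EuclideanSpace ℂ d}
    (hc : RapidDecay c) (hcs : IsConjSymm c) (x : UnitAddTorus d) :
    EuclideanSpace.conjVec (fourierSynth c x) = fourierSynth c x := by
  rw [fourierSynth, ← EuclideanSpace.conjVecL_apply,
    ContinuousLinearMap.map_tsum _ (hc.hasSum_fourierSynth x).summable]
  simp only [EuclideanSpace.conjVecL_apply]
  have h : ∀ m, EuclideanSpace.conjVec (mFourier m x • c m) = mFourier (-m) x • c (-m) :=
    fun m => by rw [EuclideanSpace.conjVec_smul, hcs m, mFourier_neg]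
  simp_rw [h]
  exact (Equiv.neg (d → ℤ)).tsum_eq (fun m => mFourier m x • c m)

/-- For a conjugate-symmetric rapidly decaying family, **no information is lost in the real part
of the synthesis**: `complexify ∘ (Re ∘ F_c) = F_c`. [folklore] -/
theorem RapidDecay.complexify_realPart_fourierSynth {c : (d → ℤ) → EuclideanSpace ℂ d}
    (hc : RapidDecay c) (hcs : IsConjSymm c) :
    (EuclideanSpace.complexify ∘ fun x => EuclideanSpace.realPart (fourierSynth c x)) =
      fourierSynth c :=
  funext fun x => EuclideanSpace.complexify_realPart (hc.conjVec_fourierSynth_apply hcs x)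

/-- The real part of the synthesis of a rapidly decaying family is a smooth real vector field.
[folklore] -/
theorem RapidDecay.isSmooth_realPart_fourierSynth {c : (d → ℤ) → EuclideanSpace ℂ d}
    (hc : RapidDecay c) : IsSmooth (fun x => EuclideanSpace.realPart (fourierSynth c x)) :=
  IsSmooth.comp_clm (f := fourierSynth c) EuclideanSpace.realPart hc.isSmooth_fourierSynth

/-- **Fourier coefficients of the real synthesis**: `𝓕(complexify ∘ (Re ∘ F_c))(k) = c(k)` for a
conjugate-symmetric rapidly decaying `c` (Grafakos 2014, Prop. 3.2.5 / §3.1.1). [folklore] -/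
theorem RapidDecay.mFourierCoeff_realPart_fourierSynth {c : (d → ℤ) → EuclideanSpace ℂ d}
    (hc : RapidDecay c) (hcs : IsConjSymm c) (k : d → ℤ) :
    mFourierCoeff
        (EuclideanSpace.complexify ∘ fun x => EuclideanSpace.realPart (fourierSynth c x)) k =
      c k := by
  rw [hc.complexify_realPart_fourierSynth hcs, hc.mFourierCoeff_fourierSynth]

/-! ### Compactness of Gevrey balls -/

variable [DecidableEq d]

/-- **Compactness of Gevrey balls of smooth divergence-free mean-zero fields on `T^d`.** Let
`σ > 0` and let `vₙ : T^d → ℝ^d` be smooth, divergence free and mean zero with the uniform Gevrey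
bound `∑_{k∈S} e^{2σ|k|} ‖𝓕(complexify ∘ vₙ)(k)‖² ≤ C` for all `n` and all finite `S ⊆ ℤ^d`. Then
there are a smooth, divergence-free, mean-zero `w` obeying the same bound and a subsequence `ψ` with
`∫ ‖v_{ψ n} - w‖² → 0` and `‖∇(v_{ψ n} - w)‖₂² → 0` (Foias–Temam 1989 Gevrey classes; diagonal
extraction, Fourier synthesis of the limit coefficients, and Tannery's theorem with the majorant
`4C(1 + |k|²)e^{-2σ|k|}`). [folklore] -/
theorem exists_smooth_limit_of_gevrey_bound {σ C : ℝ} (hσ : 0 < σ)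
    (v : ℕ → UnitAddTorus d → EuclideanSpace ℝ d)
    (hv : ∀ n, IsSmooth (v n)) (hdiv : ∀ n, IsDivFree (v n)) (hmean : ∀ n, HasZeroMean (v n))
    (hG : ∀ n, ∀ S : Finset (d → ℤ), ∑ k ∈ S, Real.exp (2 * σ * Real.sqrt (freqNormSq k)) *
      ‖mFourierCoeff (EuclideanSpace.complexify ∘ v n) k‖ ^ 2 ≤ C) :
    ∃ (w : UnitAddTorus d → EuclideanSpace ℝ d) (ψ : ℕ → ℕ), StrictMono ψ ∧ IsSmooth w ∧
      IsDivFree w ∧ HasZeroMean w ∧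
      (∀ S : Finset (d → ℤ), ∑ k ∈ S, Real.exp (2 * σ * Real.sqrt (freqNormSq k)) *
        ‖mFourierCoeff (EuclideanSpace.complexify ∘ w) k‖ ^ 2 ≤ C) ∧
      Tendsto (fun n => ∫ x, ‖v (ψ n) x - w x‖ ^ 2) atTop (𝓝 0) ∧
      Tendsto (fun n => gradNormSq (v (ψ n) - w)) atTop (𝓝 0) := by
  -- the coefficient families and the Gevrey weight
  set a : ℕ → (d → ℤ) → EuclideanSpace ℂ d := fun n k =>
    mFourierCoeff (EuclideanSpace.complexify ∘ v n) k
  set E : (d → ℤ) → ℝ := fun k => Real.exp (2 * σ * Real.sqrt (freqNormSq k)) with hE_def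
  have hG' : ∀ n, ∀ S : Finset (d → ℤ), ∑ k ∈ S, E k * ‖a n k‖ ^ 2 ≤ C := fun n S => hG n S
  -- Steps 1–2: diagonal extraction and the limit family `b`
  obtain ⟨ψ, hψ, b, hb, hbG⟩ := exists_strictMono_tendsto_of_gevrey_bound a hG'
  have hEinv : ∀ k, (E k)⁻¹ = Real.exp (-(2 * σ * Real.sqrt (freqNormSq k))) := fun k => by
    rw [hE_def, Real.exp_neg]
  have hmode : ∀ n k, ‖a n k‖ ^ 2 ≤ C * (E k)⁻¹ := fun n k => by
    have h := hG' n {k}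
    rw [Finset.sum_singleton] at h
    rw [← div_eq_mul_inv, le_div_iff₀ (Real.exp_pos _), mul_comm]
    exact h
  have hbmode : ∀ k, ‖b k‖ ^ 2 ≤ C * (E k)⁻¹ := fun k => by
    have h := hbG {k}
    rw [Finset.sum_singleton] at h
    rw [← div_eq_mul_inv, le_div_iff₀ (Real.exp_pos _), mul_comm]
    exact h
  -- Step 3: `b` decays rapidly and is conjugate symmetric; the limit field `w`
  have hbr : RapidDecay b :=
    rapidDecay_of_norm_sq_le_mul_exp_neg hσ fun k => by rw [← hEinv]; exact hbmode k
  have hacs : ∀ n k, a n (-k) = EuclideanSpace.conjVec (a n k) := fun n k =>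
    isConjSymm_mFourierCoeff (hv n).integrable k
  have hbcs : IsConjSymm b := by
    intro k
    have h2 : Tendsto (fun n => EuclideanSpace.conjVec (a (ψ n) k)) atTop
        (𝓝 (EuclideanSpace.conjVec (b k))) := by
      simpa only [Function.comp_def, EuclideanSpace.conjVecL_apply] using
        (EuclideanSpace.conjVecL.continuous.tendsto (b k)).comp (hb k)
    exact tendsto_nhds_unique (hb (-k)) (h2.congr fun n => (hacs (ψ n) k).symm)
  set w : UnitAddTorus d → EuclideanSpace ℝ d := fun x => EuclideanSpace.realPart (fourierSynth b x)
  have hws : IsSmooth w := hbr.isSmooth_realPart_fourierSynth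
  have hwc : ∀ k, mFourierCoeff (EuclideanSpace.complexify ∘ w) k = b k := fun k =>
    hbr.mFourierCoeff_realPart_fourierSynth hbcs k
  -- Step 5 preliminaries: coefficients of the differences and the Tannery majorant
  have hdiff : ∀ n k,
      mFourierCoeff (EuclideanSpace.complexify ∘ (v (ψ n) - w)) k = a (ψ n) k - b k := fun n k => by
    rw [complexify_comp_sub, mFourierCoeff_sub (hv _).complexify_comp.integrable
      hws.complexify_comp.integrable, hwc]
  set f : ℕ → (d → ℤ) → ℝ := fun n k => (1 + freqNormSq k) * ‖a (ψ n) k - b k‖ ^ 2 with hf_def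
  have hf_nonneg : ∀ n k, 0 ≤ f n k := fun n k =>
    mul_nonneg (zero_le_one.trans (one_le_one_add_freqNormSq k)) (sq_nonneg _)
  have hbound : Summable fun k : d → ℤ =>
      4 * C * ((1 + freqNormSq k) ^ 1 * Real.exp (-(2 * σ * Real.sqrt (freqNormSq k)))) :=
    (summable_one_add_freqNormSq_pow_mul_exp_neg (mul_pos two_pos hσ) 1).mul_left (4 * C)
  have hf_le : ∀ n k, f n k ≤
      4 * C * ((1 + freqNormSq k) ^ 1 * Real.exp (-(2 * σ * Real.sqrt (freqNormSq k)))) := by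
    intro n k
    rw [pow_one, ← hEinv, hf_def]
    have h1 : ‖a (ψ n) k - b k‖ ^ 2 ≤ 4 * (C * (E k)⁻¹) := by
      have hn := norm_sub_le (a (ψ n) k) (b k)
      nlinarith [hmode (ψ n) k, hbmode k, norm_nonneg (a (ψ n) k - b k),
        norm_nonneg (a (ψ n) k), norm_nonneg (b k), sq_nonneg (‖a (ψ n) k‖ - ‖b k‖)]
    calc (1 + freqNormSq k) * ‖a (ψ n) k - b k‖ ^ 2
        ≤ (1 + freqNormSq k) * (4 * (C * (E k)⁻¹)) :=
          mul_le_mul_of_nonneg_left h1 (zero_le_one.trans (one_le_one_add_freqNormSq k))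
      _ = 4 * C * ((1 + freqNormSq k) * (E k)⁻¹) := by ring
  have hfsum : ∀ n, Summable (f n) := fun n =>
    hbound.of_nonneg_of_le (hf_nonneg n) (hf_le n)
  have hT : Tendsto (fun n => ∑' k, f n k) atTop (𝓝 0) := by
    have hpt : ∀ k, Tendsto (fun n => f n k) atTop (𝓝 0) := by
      intro k
      have h1 : Tendsto (fun n => a (ψ n) k - b k) atTop (𝓝 0) := by
        simpa using (hb k).sub_const (b k)
      simpa [hf_def] using ((h1.norm).pow 2).const_mul (1 + freqNormSq k)
    have h := tendsto_tsum_of_dominated_convergence (𝓕 := atTop) (f := f)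
      (g := fun _ => (0 : ℝ)) hbound hpt (Eventually.of_forall fun n k => by
        rw [Real.norm_of_nonneg (hf_nonneg n k)]; exact hf_le n k)
    simpa using h
  have hL2 : ∀ n, ∫ x, ‖v (ψ n) x - w x‖ ^ 2 ≤ ∑' k, f n k := by
    intro n
    have hP := hasSum_sq_norm_mFourierCoeff_complexify (((hv (ψ n)).sub hws).memLp 2)
    rw [show (fun x => ‖v (ψ n) x - w x‖ ^ 2) = fun x => ‖(v (ψ n) - w) x‖ ^ 2 from rfl,
      ← hP.tsum_eq]
    refine hP.summable.tsum_le_tsum (fun k => ?_) (hfsum n)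
    rw [hdiff n k]
    exact le_mul_of_one_le_left (sq_nonneg _) (one_le_one_add_freqNormSq k)
  have hH1 : ∀ n, gradNormSq (v (ψ n) - w) ≤ 4 * Real.pi ^ 2 * ∑' k, f n k := by
    intro n
    have h := tsum_freqNormSq_mul_enorm_sq_mFourierCoeff_complexify ((hv (ψ n)).sub hws)
    have hle : ENNReal.ofReal ((4 * Real.pi ^ 2)⁻¹ * gradNormSq (v (ψ n) - w)) ≤
        ENNReal.ofReal (∑' k, f n k) := by
      rw [← h, ENNReal.ofReal_tsum_of_nonneg (hf_nonneg n) (hfsum n)]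
      refine ENNReal.tsum_le_tsum fun k => ?_
      rw [hdiff n k, ← ofReal_norm, ← ENNReal.ofReal_pow (norm_nonneg _),
        ← ENNReal.ofReal_mul (freqNormSq_nonneg k)]
      exact ENNReal.ofReal_le_ofReal
        (mul_le_mul_of_nonneg_right (by linarith) (sq_nonneg _))
    have hle' := (ENNReal.ofReal_le_ofReal_iff (tsum_nonneg (hf_nonneg n))).1 hle
    rwa [inv_mul_le_iff₀ (by positivity)] at hle'
  -- assemble
  refine ⟨w, ψ, hψ, hws, ?_, ?_, ?_, ?_, ?_⟩
  · -- Step 4a: divergence free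
    refine isDivFree_of_sum_mul_mFourierCoeff_eq_zero hws fun k => ?_
    rw [hwc k]
    have hL : Continuous fun z : EuclideanSpace ℂ d => ∑ j, (k j : ℂ) * z j :=
      continuous_finsetSum _ fun j _ => continuous_const.mul (PiLp.continuous_apply 2 _ j)
    have h1 : Tendsto (fun n => ∑ j, (k j : ℂ) * a (ψ n) k j) atTop
        (𝓝 (∑ j, (k j : ℂ) * b k j)) :=
      (hL.tendsto (b k)).comp (hb k)
    have h0 : ∀ n, ∑ j, (k j : ℂ) * a (ψ n) k j = 0 := fun n =>
      (hdiv (ψ n)).sum_mul_mFourierCoeff_eq_zero (hv _) k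
    exact tendsto_nhds_unique (h1.congr h0) tendsto_const_nhds
  · -- Step 4b: zero mean
    refine hasZeroMean_of_mFourierCoeff_zero ?_
    rw [hwc 0]
    have h0 : ∀ n, a (ψ n) 0 = 0 := fun n =>
      mFourierCoeff_complexify_zero_of_hasZeroMean (hv _).integrable (hmean _)
    exact tendsto_nhds_unique ((hb 0).congr h0) tendsto_const_nhds
  · -- the Gevrey bound of the limit
    intro S
    simpa only [hwc] using hbG S
  · -- Step 5a: `L²` convergence
    exact tendsto_of_tendsto_of_tendsto_of_le_of_le tendsto_const_nhds hT
      (fun n => integral_nonneg fun x => sq_nonneg _) hL2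
  · -- Step 5b: `H¹` convergence
    have hT' : Tendsto (fun n => 4 * Real.pi ^ 2 * ∑' k, f n k) atTop (𝓝 0) := by
      simpa using hT.const_mul (4 * Real.pi ^ 2)
    exact tendsto_of_tendsto_of_tendsto_of_le_of_le tendsto_const_nhds hT'
      (fun n => gradNormSq_nonneg _) hH1

end Torus

end Literature.Analysis.FunctionSpaces

end
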